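import Summits.Ventures.PercRepro.TriangleCapEightC

/-!
# PercRepro — the triangle cap at nullity `8`: `P(8) = 13`, PART D — the bookkeeping (p3, gen 22)

With `H ⊆ E` closed under «two points of a triangle» (`hF1`) and `Y = E ∖ H`, every triangle `T` has
`|T ∩ H| ∈ {0, 1, 3}` and `|T ∩ H| + |T ∩ Y| = 3` (`ncard_inter_add`, `ncard_inter_ne_two`). Writing
`i / a / b` for the numbers of triangles with `|T ∩ H| = 3 / 1 / 0`:
`#𝒯 = i + a + b`, `Σ_{v ∈ H} t(v) = 3i + a`, `Σ_{y ∈ Y} t(y) = 2a + 3b`, `Σ_T C(|T ∩ Y|, 2) = a + 3b ≤ C(|Y|, 2)`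
(`bookkeeping`).

Axioms: standard.
-/

open scoped Matroid

namespace PercRepro

namespace TriangleCap

open Set Finset

open scoped Classical

variable {α : Type}

/-- `|T ∩ H| + |T ∩ (E ∖ H)| = |T|` for a triangle `T ⊆ E`. -/
theorem ncard_inter_add (M : Matroid α) [M.Finite] {H : Set α} {T : Set α} (hT : T ∈ ThmN.triangles M) :
    (T ∩ H).ncard + (T ∩ (M.E \ H)).ncard = 3 := by
  have hTE : T ⊆ M.E := hT.1.subset_ground
  have hfin : T.Finite := M.ground_finite.subset hTE
  have hdisj : Disjoint (T ∩ H) (T ∩ (M.E \ H)) := by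
    rw [Set.disjoint_left]
    intro z hz hz'
    exact hz'.2.2 hz.2
  rw [← Set.ncard_union_eq hdisj (hfin.subset Set.inter_subset_left) (hfin.subset Set.inter_subset_left)]
  have : T ∩ H ∪ T ∩ (M.E \ H) = T := by
    ext z
    constructor
    · rintro (hz | hz)
      · exact hz.1
      · exact hz.1
    · intro hz
      by_cases hzH : z ∈ H
      · exact Or.inl ⟨hz, hzH⟩
      · exact Or.inr ⟨hz, hTE hz, hzH⟩
  rw [this, hT.2]

/-- A triangle with `|T ∩ H| = 3` lies in `H`. -/
theorem subset_of_ncard_inter_eq_three (M : Matroid α) [M.Finite] {H : Set α} {T : Set α}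
    (hT : T ∈ ThmN.triangles M) (h3 : (T ∩ H).ncard = 3) : T ⊆ H := by
  have hfin : T.Finite := M.ground_finite.subset hT.1.subset_ground
  have : T ∩ H = T := Set.eq_of_subset_of_ncard_le Set.inter_subset_left (by rw [h3, hT.2]) hfin
  intro z hz
  rw [← this] at hz
  exact hz.2

/-- Under `hF1` (two points of a triangle in `H` put the triangle in `H`), `|T ∩ H| ≠ 2`. -/
theorem ncard_inter_ne_two (M : Matroid α) [M.Finite] {H : Set α}
    (hF1 : ∀ T ∈ ThmN.triangles M, ∀ a ∈ T, ∀ b ∈ T, a ≠ b → a ∈ H → b ∈ H → T ⊆ H)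
    {T : Set α} (hT : T ∈ ThmN.triangles M) : (T ∩ H).ncard ≠ 2 := by
  intro h2
  obtain ⟨a, b, hab, hab'⟩ := Set.ncard_eq_two.1 h2
  have ha : a ∈ T ∩ H := by rw [hab']; simp
  have hb : b ∈ T ∩ H := by rw [hab']; simp
  have hTH := hF1 T hT a ha.1 b hb.1 hab ha.2 hb.2
  have : T ∩ H = T := Set.inter_eq_left.2 hTH
  rw [this, hT.2] at h2
  omega

/-- `|T ∩ H| ∈ {0, 1, 3}`. -/
theorem ncard_inter_mem (M : Matroid α) [M.Finite] {H : Set α}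
    (hF1 : ∀ T ∈ ThmN.triangles M, ∀ a ∈ T, ∀ b ∈ T, a ≠ b → a ∈ H → b ∈ H → T ⊆ H)
    {T : Set α} (hT : T ∈ ThmN.triangles M) :
    (T ∩ H).ncard = 0 ∨ (T ∩ H).ncard = 1 ∨ (T ∩ H).ncard = 3 := by
  have h1 := ncard_inter_add M (H := H) hT
  have h2 := ncard_inter_ne_two M hF1 hT
  omega

/-- **The bookkeeping.** -/
theorem bookkeeping (M : Matroid α) [M.Finite] (hC1 : ∀ L ⊆ M.E, M.eRk L = 2 → L.ncard ≤ 3)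
    (𝒯 : Finset (Set α)) (h𝒯 : ∀ T, T ∈ 𝒯 ↔ T ∈ ThmN.triangles M) {H : Set α} (hH : H ⊆ M.E)
    (hF1 : ∀ T ∈ ThmN.triangles M, ∀ a ∈ T, ∀ b ∈ T, a ≠ b → a ∈ H → b ∈ H → T ⊆ H) :
    𝒯.card = (𝒯.filter (fun T => (T ∩ H).ncard = 0)).card + (𝒯.filter (fun T => (T ∩ H).ncard = 1)).card +
        (𝒯.filter (fun T => (T ∩ H).ncard = 3)).card ∧
    ∑ v ∈ (M.ground_finite.subset hH).toFinset, (ThmN.trianglesThrough M v).ncard =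
        (𝒯.filter (fun T => (T ∩ H).ncard = 1)).card + 3 * (𝒯.filter (fun T => (T ∩ H).ncard = 3)).card ∧
    ∑ y ∈ (M.ground_finite.subset Set.sdiff_subset : (M.E \ H).Finite).toFinset,
        (ThmN.trianglesThrough M y).ncard =
        3 * (𝒯.filter (fun T => (T ∩ H).ncard = 0)).card + 2 * (𝒯.filter (fun T => (T ∩ H).ncard = 1)).card ∧
    ∑ T ∈ 𝒯, Nat.choose (T ∩ (M.E \ H)).ncard 2 =
        3 * (𝒯.filter (fun T => (T ∩ H).ncard = 0)).card + (𝒯.filter (fun T => (T ∩ H).ncard = 1)).card ∧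
    3 * (𝒯.filter (fun T => (T ∩ H).ncard = 0)).card + (𝒯.filter (fun T => (T ∩ H).ncard = 1)).card ≤
        Nat.choose (M.E \ H).ncard 2 ∧
    (𝒯.filter (fun T => (T ∩ H).ncard = 3)).card = {T ∈ ThmN.triangles M | T ⊆ H}.ncard := by
  have hHfin : H.Finite := M.ground_finite.subset hH
  have hYfin : (M.E \ H).Finite := M.ground_finite.subset Set.sdiff_subset
  have hg : ∀ T ∈ 𝒯, (T ∩ H).ncard = 0 ∨ (T ∩ H).ncard = 1 ∨ (T ∩ H).ncard = 3 :=
    fun T hT => ncard_inter_mem M hF1 ((h𝒯 T).1 hT)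
  have hpair : ∀ T ∈ 𝒯, ∀ T' ∈ 𝒯, T ≠ T' → ∀ p q, p ≠ q → p ∈ T → p ∈ T' → q ∈ T → q ∈ T' → False :=
    fun T hT T' hT' hne p q hpq hp hp' hq hq' =>
      S1.two_triangles_share_pair M hC1 ((h𝒯 T).1 hT) ((h𝒯 T').1 hT') hne hp hp' hq hq' hpq
  have hchoose : ∑ T ∈ 𝒯, Nat.choose (T ∩ (M.E \ H)).ncard 2 =
      3 * (𝒯.filter (fun T => (T ∩ H).ncard = 0)).card + (𝒯.filter (fun T => (T ∩ H).ncard = 1)).card := by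
    have hY : ∀ T ∈ 𝒯, Nat.choose (T ∩ (M.E \ H)).ncard 2 = Nat.choose (3 - (T ∩ H).ncard) 2 := by
      intro T hT
      have := ncard_inter_add M (H := H) ((h𝒯 T).1 hT)
      congr 1; omega
    rw [Finset.sum_congr rfl hY]
    have := sum_three_valued 𝒯 (fun T => (T ∩ H).ncard) (fun k => Nat.choose (3 - k) 2) hg
    rw [this]
    simp
  refine ⟨?_, ?_, ?_, hchoose, ?_, ?_⟩
  · -- the partition count: the three-valued sum of the constant `1`
    have := sum_three_valued 𝒯 (fun T => (T ∩ H).ncard) (fun _ => 1) hg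
    simp only [Finset.sum_const, smul_eq_mul, mul_one, one_mul] at this
    omega
  · rw [sum_degree_eq M 𝒯 h𝒯 hHfin]
    have := sum_three_valued 𝒯 (fun T => (T ∩ H).ncard) (fun k => k) hg
    rw [this]; ring
  · rw [sum_degree_eq M 𝒯 h𝒯 hYfin]
    have hY : ∀ T ∈ 𝒯, (T ∩ (M.E \ H)).ncard = 3 - (T ∩ H).ncard := by
      intro T hT
      have := ncard_inter_add M (H := H) ((h𝒯 T).1 hT)
      omega
    rw [Finset.sum_congr rfl hY]
    have := sum_three_valued 𝒯 (fun T => (T ∩ H).ncard) (fun k => 3 - k) hg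
    simp only [Nat.sub_zero, Nat.sub_self, zero_mul, add_zero] at this
    rw [this]
  · rw [← hchoose]
    exact sum_choose_two_le 𝒯 hYfin hpair
  · rw [← Set.ncard_coe_finset]
    congr 1
    ext T
    simp only [Finset.coe_filter, Set.mem_setOf_eq, h𝒯]
    constructor
    · exact fun h => ⟨h.1, subset_of_ncard_inter_eq_three M h.1 h.2⟩
    · intro h
      refine ⟨h.1, ?_⟩
      rw [Set.inter_eq_left.2 h.2, h.1.2]

end TriangleCap

end PercRepro
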